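import Literature.Probability.PointProcesses.LensConsistentLaw
import Mathlib.Analysis.Normed.Group.Basic
import Mathlib.Algebra.Order.Archimedean.Real.Basic
import Mathlib.Order.ConditionallyCompleteLattice.Basic
import HarnessLib

/-!
# Transfer level values: the dual side of the finite-level transfer hierarchy

Fix a separation `δ`, a level (range) `R` and a *site functional* `f` assigning a real number
`f N x i` to particle `i` of a finite configuration `x : Fin N → E` (think `E = ℝ³` and
`f = ½ · (one-centre Lennard-Jones energy)`; the instances live in
`Literature.MathematicalPhysics.StatisticalMechanics.PairLevelValue`). A **pattern-local transfer
rule of range `R`** is a function `Φ : E → Finset E → Finset E → ℝ`: `Φ v P Q` is the amount sent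
from a particle `i` to a particle `j` at relative position `v = x_j − x_i`, `|v| ≤ R`, allowed to
depend only on the two `R`-patterns `P = P_R(i)`, `Q = P_R(j)` (the relative positions of the
other particles within distance `R`, `relPattern`). Antisymmetrising, particle `i` receives the
**transfer balance**
`Σ_{j ≠ i, |x_j − x_i| ≤ R} [Φ(x_j − x_i, P_R(i), P_R(j)) − Φ(x_i − x_j, P_R(j), P_R(i))]`
(`transferSum`), which sums to zero over every finite configuration (`sum_transferSum_eq_zero`).
The rule **certifies the constant `c` at level `R`** (`IsTransferCertificate`) if
`c ≤ f N x i + transferSum R Φ x i` at every particle of every finite `δ`-separated configuration,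
and the **transfer level value** is

  `transferLevelValue f δ R = sSup {c | ∃ Φ, IsTransferCertificate f δ R Φ c}`.

This is the value of the dual linear program of the level-`R` relaxation of route
`AtomisticToContinuum/Crystallization/FrustrationRangeLP` (items `TransferDuality`,
`FrustrationFloor`, `CoordinationGapCertificates`): a localised energy corrected by zero-sum
transfers is a dual certificate — the continuum, pattern-local analogue of passing to an
*equivalent potential* whose local terms are minimised simultaneously (an m-potential;
Holsztyński–Sławny 1978, §1 "two potentials are equivalent if they yield the same relative
Hamiltonian", §3 Criterium) and of Lagarias's *admissible score functions* for sphere packings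
(bounded, local, translation-invariant reapportionings yielding a local density inequality;
Lagarias 2002, Def. 2.4, Thm. 2.1). The primal objects of the same program are the
lens-consistent rooted laws of `Literature.Probability.PointProcesses.LensConsistentLaw`
(continuum Kaburagi–Kanamori configurational polytope).

## Contents (definitions with bodies; all lemmas proved)
* `relPattern R x i`, `transferSum R Φ x i`, `IsTransferCertificate f δ R Φ c`,
  `transferLevelSet f δ R`, `transferLevelValue f δ R`, over any normed group `E` with decidable
  equality (the route: `EuclideanSpace ℝ (Fin 3)`);
* zero-sum and **weak duality**: `sum_transferSum_eq_zero`; a certified `c` is at most the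
  average `(Σ_i f N x i)/N` over any `δ`-separated configuration
  (`IsTransferCertificate.mul_le_sum`, `transferLevelValue_le_sum_div`), in particular at most
  `f` of an isolated particle (`bddAbove_transferLevelSet`, `transferLevelValue_nonpos`);
* the feasible set is a down-set containing every uniform lower bound of `f` (rule `Φ = 0`,
  `mem_transferLevelSet_of_forall_le`): `−∞ <` value as soon as `f` is bounded below on
  `δ`-separated configurations; `le_transferLevelValue`, `exists_certificate_of_lt`;
* **monotonicity** in the separation (`transferLevelValue_mono_sep`) and, for a FIXED site
  functional, in the level — a level-`R` rule is a level-`R'` rule for `R ≤ R'` (`extendRule`,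
  `transferSum_extendRule`, `IsTransferCertificate.extend`, `transferLevelValue_mono_level`).

## Design notes
* Values are real `sSup`s, as requested by the route: the feasible set is always bounded above
  (one-particle configuration), and `sSup ∅ = 0` is the junk value when `f` admits no
  certificate at all (e.g. separation `δ ≤ 0` for Lennard-Jones); lemmas needing a genuine
  supremum take `(transferLevelSet f δ R).Nonempty`.
* Patterns and balls are CLOSED (`dist ≤ R`), the pattern radius equals the transfer range, and
  `relPattern` / `transferSum` / the separation clause are written literally as in decl
  `CoordinationGapCertificates` of the route, whose certificate clause is thus an
  `IsTransferCertificate` by `Iff.rfl`.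
* No sign hypotheses on `δ`, `R` are built in (for `R < 0` all balances vanish).
* NOT here: strong duality with lens-consistent laws and convergence of level values as
  `R → ∞` (route item `TransferDuality`), certified numerical values (`FrustrationFloor`).

## References
* W. Holsztyński, J. Sławny, *Peierls condition and number of ground states*, Comm. Math. Phys.
  61 (1978) 177–190, §1, §3. [HolsztynskiSlawny1978]
* J. C. Lagarias, *Bounds for local density of sphere packings and the Kepler conjecture*,
  Discrete Comput. Geom. 27 (2002) 165–193, Def. 2.4, Thm. 2.1. [Lagarias2002LocalDensity]
* M. Kaburagi, J. Kanamori, *A method of determining the ground state of the extended-range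
  classical lattice gas model*, Progr. Theor. Phys. 54 (1975) 30–44. [KaburagiKanamori1975]
-/

noncomputable section

open scoped BigOperators
open Finset

namespace Literature.MathematicalPhysics.StatisticalMechanics

open Literature.Probability.PointProcesses (ballPattern)

/-! ### Patterns, transfer rules, certificates, level values -/

section General

variable {E : Type*} [NormedAddCommGroup E] [DecidableEq E]

/-- The **`R`-pattern** of particle `i` in the finite configuration `x`: the relative positions
`x k − x i` of the other particles `k ≠ i` within (closed) distance `R` — the rooted pattern seen
from `x i`. Written exactly as `pat` in the route decl `CoordinationGapCertificates`. [folklore] -/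
def relPattern (R : ℝ) {N : ℕ} (x : Fin N → E) (i : Fin N) : Finset E :=
  Finset.image (fun k : Fin N => x k - x i)
    (Finset.univ.filter fun k : Fin N => k ≠ i ∧ dist (x i) (x k) ≤ R)

/-- The **transfer balance** at particle `i` of a pattern-local transfer rule `Φ` of range `R`:
`Σ_{j ≠ i, |x_j − x_i| ≤ R} [Φ(x_j − x_i, P_R(i), P_R(j)) − Φ(x_i − x_j, P_R(j), P_R(i))]`
(received minus sent, antisymmetrised). [folklore] -/
def transferSum (R : ℝ) (Φ : E → Finset E → Finset E → ℝ) {N : ℕ} (x : Fin N → E) (i : Fin N) : ℝ :=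
  ∑ j ∈ Finset.univ.erase i,
    (if dist (x i) (x j) ≤ R then
        Φ (x j - x i) (relPattern R x i) (relPattern R x j) -
          Φ (x i - x j) (relPattern R x j) (relPattern R x i)
      else 0)

/-- The rule `Φ` **certifies the constant `c` at level `R`** for the site functional `f` at
separation `δ`: on every finite configuration with pairwise distances `≥ δ`, at every particle,
`c ≤ f N x i + transferSum R Φ x i` (a dual-feasible point of the level-`R` program; the
continuum analogue of an m-potential bound, Holsztyński–Sławny, and of an admissible local
inequality, Lagarias). [cite: Lagarias2002LocalDensity, Def. 2.4 and Thm. 2.1] -/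
def IsTransferCertificate (f : (N : ℕ) → (Fin N → E) → Fin N → ℝ) (δ R : ℝ)
    (Φ : E → Finset E → Finset E → ℝ) (c : ℝ) : Prop :=
  ∀ (N : ℕ) (x : Fin N → E), (∀ i j : Fin N, i ≠ j → δ ≤ dist (x i) (x j)) →
    ∀ i : Fin N, c ≤ f N x i + transferSum R Φ x i

/-- The **feasible set of the dual program at level `R`**: constants certified by some
pattern-local transfer rule of range `R`. [folklore] -/
def transferLevelSet (f : (N : ℕ) → (Fin N → E) → Fin N → ℝ) (δ R : ℝ) : Set ℝ :=
  {c | ∃ Φ : E → Finset E → Finset E → ℝ, IsTransferCertificate f δ R Φ c}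

/-- The **transfer level value** `v(δ, R) = sup {c | ∃ Φ, Φ certifies c at level R}`, the value of
the dual of the level-`R` transfer/marginal program (a real `sSup`: junk value `0` when no
constant is certifiable). [folklore] -/
def transferLevelValue (f : (N : ℕ) → (Fin N → E) → Fin N → ℝ) (δ R : ℝ) : ℝ :=
  sSup (transferLevelSet f δ R)

variable {f : (N : ℕ) → (Fin N → E) → Fin N → ℝ} {δ δ' R R' c c' : ℝ}
  {Φ : E → Finset E → Finset E → ℝ}

/-- Unfolding of membership in the feasible set. [folklore] -/
theorem mem_transferLevelSet_iff :
    c ∈ transferLevelSet f δ R ↔ ∃ Φ : E → Finset E → Finset E → ℝ, IsTransferCertificate f δ R Φ c :=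
  Iff.rfl

/-- The zero rule transfers nothing. [folklore] -/
@[simp] theorem transferSum_zero (R : ℝ) {N : ℕ} (x : Fin N → E) (i : Fin N) :
    transferSum R (0 : E → Finset E → Finset E → ℝ) x i = 0 := by
  simp [transferSum]

/-- **Transfers are zero-sum**: the balances of any rule sum to `0` over a finite configuration
(the summand is antisymmetric in `(i, j)`). [folklore] -/
theorem sum_transferSum_eq_zero (R : ℝ) (Φ : E → Finset E → Finset E → ℝ) {N : ℕ}
    (x : Fin N → E) : ∑ i, transferSum R Φ x i = 0 := by
  set a : Fin N → Fin N → ℝ := fun i j =>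
    if dist (x i) (x j) ≤ R then
        Φ (x j - x i) (relPattern R x i) (relPattern R x j) -
          Φ (x i - x j) (relPattern R x j) (relPattern R x i)
      else 0 with ha
  have hanti : ∀ i j, a j i = -a i j := fun i j => by
    simp only [ha, dist_comm (x j) (x i)]
    split_ifs <;> ring
  have hdiag : ∀ i, a i i = 0 := fun i => by
    have h := hanti i i
    linarith
  have h1 : ∀ i, transferSum R Φ x i = ∑ j, a i j := fun i => by
    have h0 : transferSum R Φ x i = ∑ j ∈ Finset.univ.erase i, a i j := rfl
    rw [h0, Finset.sum_erase_eq_sub (Finset.mem_univ i), hdiag, sub_zero]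
  have hS : ∑ i, ∑ j, a i j = -∑ i, ∑ j, a i j :=
    calc ∑ i, ∑ j, a i j = ∑ i, ∑ j, -a j i :=
          Finset.sum_congr rfl fun i _ => Finset.sum_congr rfl fun j _ => hanti j i
      _ = -∑ i, ∑ j, a j i := by simp only [Finset.sum_neg_distrib]
      _ = -∑ i, ∑ j, a i j := by rw [Finset.sum_comm]
  simp only [h1]
  linarith

/-- A weaker constant is certified by the same rule (the feasible set is a down-set). [folklore] -/
theorem IsTransferCertificate.of_le (h : IsTransferCertificate f δ R Φ c) (hc : c' ≤ c) :
    IsTransferCertificate f δ R Φ c' :=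
  fun N x hx i => hc.trans (h N x hx i)

/-- A certificate at separation `δ` is a certificate at any larger separation (fewer
configurations to control). [folklore] -/
theorem IsTransferCertificate.mono_sep (h : IsTransferCertificate f δ R Φ c) (hδ : δ ≤ δ') :
    IsTransferCertificate f δ' R Φ c :=
  fun N x hx i => h N x (fun k l hkl => hδ.trans (hx k l hkl)) i

/-- **Weak duality, finite volume**: summing the pointwise inequality over a `δ`-separated
configuration of `N` particles, the transfers cancel and `N · c ≤ Σ_i f N x i`. [folklore] -/
theorem IsTransferCertificate.mul_le_sum (h : IsTransferCertificate f δ R Φ c) {N : ℕ}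
    {x : Fin N → E} (hx : ∀ i j : Fin N, i ≠ j → δ ≤ dist (x i) (x j)) :
    (N : ℝ) * c ≤ ∑ i, f N x i := by
  have h1 : ∑ _i : Fin N, c ≤ ∑ i, (f N x i + transferSum R Φ x i) :=
    Finset.sum_le_sum fun i _ => h N x hx i
  rw [Finset.sum_add_distrib, sum_transferSum_eq_zero, add_zero, Finset.sum_const,
    Finset.card_univ, Fintype.card_fin, nsmul_eq_mul] at h1
  exact h1

/-- Weak duality as an average: `c ≤ (Σ_i f N x i)/N` for `N ≥ 1`. [folklore] -/
theorem IsTransferCertificate.le_sum_div (h : IsTransferCertificate f δ R Φ c) {N : ℕ}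
    {x : Fin N → E} (hx : ∀ i j : Fin N, i ≠ j → δ ≤ dist (x i) (x j)) (hN : 0 < N) :
    c ≤ (∑ i, f N x i) / N := by
  rw [le_div_iff₀ (by exact_mod_cast hN), mul_comm]
  exact h.mul_le_sum hx

/-- In particular a certified constant is at most `f` of an isolated particle. [folklore] -/
theorem IsTransferCertificate.le_apply_one (h : IsTransferCertificate f δ R Φ c) (x : Fin 1 → E) :
    c ≤ f 1 x 0 := by
  have h1 := h.mul_le_sum (N := 1) (x := x) fun i j hij => absurd (Subsingleton.elim i j) hij
  simpa using h1

variable (f δ R) in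
/-- The feasible set is bounded above (by `f` of the one-particle configuration). [folklore] -/
theorem bddAbove_transferLevelSet : BddAbove (transferLevelSet f δ R) :=
  ⟨f 1 (fun _ => 0) 0, fun _ ⟨_, h⟩ => h.le_apply_one _⟩

/-- The feasible set is a down-set. [folklore] -/
theorem mem_transferLevelSet_of_le (hc : c ∈ transferLevelSet f δ R) (h : c' ≤ c) :
    c' ∈ transferLevelSet f δ R :=
  let ⟨Φ, hΦ⟩ := hc
  ⟨Φ, hΦ.of_le h⟩

/-- **The zero rule**: a uniform lower bound of `f` on `δ`-separated configurations is feasible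
(`Φ = 0`). [folklore] -/
theorem mem_transferLevelSet_of_forall_le {b : ℝ}
    (hb : ∀ (N : ℕ) (x : Fin N → E), (∀ i j : Fin N, i ≠ j → δ ≤ dist (x i) (x j)) →
      ∀ i : Fin N, b ≤ f N x i) :
    b ∈ transferLevelSet f δ R :=
  ⟨0, fun N x hx i => by simpa using hb N x hx i⟩

/-- A certified constant is at most the level value. [folklore] -/
theorem le_transferLevelValue (h : IsTransferCertificate f δ R Φ c) : c ≤ transferLevelValue f δ R :=
  le_csSup (bddAbove_transferLevelSet f δ R) ⟨Φ, h⟩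

/-- A feasible constant is at most the level value. [folklore] -/
theorem le_transferLevelValue_of_mem (h : c ∈ transferLevelSet f δ R) : c ≤ transferLevelValue f δ R :=
  le_csSup (bddAbove_transferLevelSet f δ R) h

/-- `−∞ <` value, quantitatively: a uniform lower bound of `f` on `δ`-separated configurations
bounds the level value from below. [folklore] -/
theorem le_transferLevelValue_of_forall_le {b : ℝ}
    (hb : ∀ (N : ℕ) (x : Fin N → E), (∀ i j : Fin N, i ≠ j → δ ≤ dist (x i) (x j)) →
      ∀ i : Fin N, b ≤ f N x i) :
    b ≤ transferLevelValue f δ R :=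
  le_transferLevelValue_of_mem (mem_transferLevelSet_of_forall_le hb)

/-- Below the value there are certificates (approximate dual optimisers). [folklore] -/
theorem exists_certificate_of_lt {a : ℝ} (hS : (transferLevelSet f δ R).Nonempty)
    (h : a < transferLevelValue f δ R) :
    ∃ (Φ : E → Finset E → Finset E → ℝ) (c : ℝ), a < c ∧ IsTransferCertificate f δ R Φ c := by
  obtain ⟨c, ⟨Φ, hΦ⟩, hac⟩ := exists_lt_of_lt_csSup hS h
  exact ⟨Φ, c, hac, hΦ⟩

/-- **Weak duality for the value**: `v(δ, R) ≤ (Σ_i f N x i)/N` for every `δ`-separated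
configuration of `N ≥ 1` particles. [folklore] -/
theorem transferLevelValue_le_sum_div (hS : (transferLevelSet f δ R).Nonempty) {N : ℕ}
    {x : Fin N → E} (hx : ∀ i j : Fin N, i ≠ j → δ ≤ dist (x i) (x j)) (hN : 0 < N) :
    transferLevelValue f δ R ≤ (∑ i, f N x i) / N :=
  csSup_le hS fun _ ⟨_, h⟩ => h.le_sum_div hx hN

/-- The value is at most `f` of an isolated particle. [folklore] -/
theorem transferLevelValue_le_apply_one (hS : (transferLevelSet f δ R).Nonempty) (x : Fin 1 → E) :
    transferLevelValue f δ R ≤ f 1 x 0 :=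
  csSup_le hS fun _ ⟨_, h⟩ => h.le_apply_one x

/-- If `f` is `≤ 0` on some one-particle configuration the value is `≤ 0` (no non-emptiness
needed: `sSup ∅ = 0`). [folklore] -/
theorem transferLevelValue_nonpos (h0 : ∃ x : Fin 1 → E, f 1 x 0 ≤ 0) : transferLevelValue f δ R ≤ 0 :=
  let ⟨x, hx⟩ := h0
  Real.sSup_nonpos fun _ ⟨_, h⟩ => (h.le_apply_one x).trans hx

/-- The feasible set grows with the separation. [folklore] -/
theorem transferLevelSet_mono_sep (hδ : δ ≤ δ') : transferLevelSet f δ R ⊆ transferLevelSet f δ' R :=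
  fun _ ⟨Φ, h⟩ => ⟨Φ, h.mono_sep hδ⟩

/-- **The value is monotone in the separation.** [folklore] -/
theorem transferLevelValue_mono_sep (hS : (transferLevelSet f δ R).Nonempty) (hδ : δ ≤ δ') :
    transferLevelValue f δ R ≤ transferLevelValue f δ' R :=
  csSup_le_csSup (bddAbove_transferLevelSet f δ' R) hS (transferLevelSet_mono_sep hδ)

/-! ### A level-`R` rule is a level-`R'` rule for `R ≤ R'` -/

/-- Restricting an `R'`-pattern to the ball of radius `R ≤ R'` gives the `R`-pattern. [folklore] -/
theorem ballPattern_relPattern (hR : R ≤ R') {N : ℕ} (x : Fin N → E) (i : Fin N) :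
    ballPattern R (relPattern R' x i) = relPattern R x i := by
  unfold ballPattern relPattern
  rw [Finset.filter_image, Finset.filter_filter]
  congr 1
  refine Finset.filter_congr fun k _ => ?_
  rw [← dist_eq_norm, dist_comm]
  exact ⟨fun h => ⟨h.1.1, h.2⟩, fun h => ⟨⟨h.1, h.2.trans hR⟩, h.2⟩⟩

variable (R Φ) in
/-- **Extension of a level-`R` rule to higher levels**: transfer `Φ(v, P ∩ B̄_R, Q ∩ B̄_R)` along
displacements `|v| ≤ R` and nothing beyond. [folklore] -/
def extendRule : E → Finset E → Finset E → ℝ :=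
  fun v P Q => if ‖v‖ ≤ R then Φ v (ballPattern R P) (ballPattern R Q) else 0

/-- At any level `R' ≥ R` the extended rule has the same balances as `Φ` at level `R`. [folklore] -/
theorem transferSum_extendRule (hR : R ≤ R') {N : ℕ} (x : Fin N → E) (i : Fin N) :
    transferSum R' (extendRule R Φ) x i = transferSum R Φ x i := by
  unfold transferSum
  refine Finset.sum_congr rfl fun j _ => ?_
  have hn : ‖x j - x i‖ = dist (x i) (x j) := by rw [← dist_eq_norm, dist_comm]
  have hn' : ‖x i - x j‖ = dist (x i) (x j) := by rw [← dist_eq_norm]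
  by_cases h : dist (x i) (x j) ≤ R
  · rw [if_pos h, if_pos (h.trans hR)]
    simp only [extendRule, hn, hn', if_pos h, ballPattern_relPattern hR]
  · simp only [extendRule, hn, hn', if_neg h, sub_zero, ite_self]

/-- **A level-`R` certificate is a level-`R'` certificate**, `R ≤ R'` (same site functional).
[folklore] -/
theorem IsTransferCertificate.extend (h : IsTransferCertificate f δ R Φ c) (hR : R ≤ R') :
    IsTransferCertificate f δ R' (extendRule R Φ) c :=
  fun N x hx i => by rw [transferSum_extendRule hR]; exact h N x hx i

/-- The feasible set grows with the level (fixed site functional). [folklore] -/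
theorem transferLevelSet_mono_level (hR : R ≤ R') : transferLevelSet f δ R ⊆ transferLevelSet f δ R' :=
  fun _ ⟨_, h⟩ => ⟨_, h.extend hR⟩

/-- **The value is monotone in the level** (for a fixed site functional, e.g. the full-range
one-centre energy; false for `R`-truncated energies). [folklore] -/
theorem transferLevelValue_mono_level (hS : (transferLevelSet f δ R).Nonempty) (hR : R ≤ R') :
    transferLevelValue f δ R ≤ transferLevelValue f δ R' :=
  csSup_le_csSup (bddAbove_transferLevelSet f δ R') hS (transferLevelSet_mono_level hR)

end General

end Literature.MathematicalPhysics.StatisticalMechanics
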